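import Literature.Probability.LatticeModels.SubcriticalFourierDiagonal
import Literature.Probability.LatticeModels.FejerKernel
import Literature.Probability.LatticeModels.DiscreteParseval
import Literature.Probability.LatticeModels.ImprovedTreeDiagramBound
import Literature.Probability.LatticeModels.HighDimTrivialityUniformProofs
import Literature.Probability.LatticeModels.CriticalTwoPointLower
import Literature.Probability.LatticeModels.LroInfraredBound
import HarnessLib

/-!
# The sliding-scale infrared bound (Aizenman–Duminil-Copin 2021, Thm 5.6): proof

Topic `Literature/Probability/LatticeModels`; family `crit-ising`. No named fact introduced, no
sorry. **Discharges** the named fact `aizenmanDuminilCopin_slidingScaleInfraredBound`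
(`ImprovedTreeDiagramBound.lean`; ADC 2021 Thm 5.6): `aizenmanDuminilCopin_slidingScaleInfraredBound_holds`.

## Statement (as vendored)

For `d ≥ 3` there is `C = C(d) > 0` such that for all `0 < β ≤ β_c`, reals `1 ≤ ℓ ≤ L` and every
Gibbs state `μ ∈ 𝒢(β, 0)` of the nearest-neighbour Ising model on `ℤ^d`,
`χ_L(β)/L² ≤ (C/β) χ_ℓ(β)/ℓ²`, `χ_L = ∑_{x ∈ Λ_L} ⟨σ₀σ_x⟩_μ` (`boxSusceptibility`).

## Proof (Aizenman–Duminil-Copin 2021, §5.2–5.3, proof of Thm 5.6, p. 19–20, in the tree's rendering)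

The printed proof tests `Ŝ_β` against smooth bumps at the scales `1/L` and `1/ℓ` and uses three
structural facts about `Ŝ_β`: (i) monotone decay in each `|p_i|`, (ii) monotone growth of
`ℰ₁(p_i)Ŝ_β(p)` in `|p_i|` (Prop. 5.4 (i),(ii), transfer matrix; tree: `TorusTransferSpectral` →
`SubcriticalFourier`), (iii) the diagonal monotonicity of `Ŝ^{mod}` giving the merging / un-merging of
coordinates (Prop. 5.4 (iii), Cor. 5.5; tree: `RotatedTorus*` → `SubcriticalFourierDiagonal`), plus the
infrared bound (5.12) and `Ŝ ≥ 0`. This file: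

* Part 1 — pointwise consequences for `Ŝ_β`, `0 < β < β_c`: killing coordinates
  (`twoPointPlusFourier_le_single`), moving to the first axis (`twoPointPlusFourier_single_eq`), the
  scaling `Ŝ(m e₀) ≤ (π²/4)(M/m)² Ŝ(M e₀)` for `0 < m ≤ M ≤ π` (`twoPointPlusFourier_single_le_scale`,
  from (ii) and `2u²/π² ≤ 1 - cos u ≤ u²/2`), the merging chain
  `Ŝ((∑qᵢ)e₀) ≤ Ŝ(q) + (d-1)/(4β)` (`twoPointPlusFourier_single_sum_le`), whence the **region-A bound**
  `Ŝ(p) ≤ (π²/4) d²λ² [Ŝ(λp) + (d-1)/(4β)]` for `λ∑|pᵢ| ≤ π/2` and the **region-B bound**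
  `Ŝ(p) ≤ d²λ²/β` when some `|p_j| > π/(2dλ)` (infrared bound).
* Part 2 — the two-scale comparison on the momentum grid `2πk/(λΛ')` with the Fejér kernel as the
  bump (`FejerKernel`, `DiscreteParseval`): `χ^F_{λℓ} ≤ (ℓ/Λ')^d Ŝ(0) + c_A λ²[∑F_ℓ S_{Λ'} + (d-1)/(4β)]
  + d²λ²/β` (`fejerSusc_le_grid`; region A is re-summed over the coarser grid through the injective
  map `k ↦ rep(k) mod Λ'`, region B is bounded by the grid mass `∑_k F̂_L = Λ^d`), and `Λ' → ∞`
  (`fejerSusc_scale_le`).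
* Part 3 — boxes versus Fejér weights (`χ^F_{ℓ'} ≤ χ_ℓ`, `χ_L ≤ 2^d χ^F_{L'}`), integer rounding of the
  real scales (`λ ≤ 5L/ℓ`), the constant `cSliding d'' = 25·2^d (c_A β_c + c_A(d-1)/4 + d²)`; then
  `β < β_c` for the plus (= free = unique) state (`boxSusceptibility_sliding_of_lt_criticalBeta`) and
  `β = β_c` by the left-continuity of the free state (ADS15 (3.18)) and the uniqueness of the critical
  Gibbs measure (`isingGibbsMeasure_twoPoint_of_facts`), which is where `d ≥ 3` enters.

The theorem is obtained for the sup-norm boxes and the constant above; no attempt is made to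
optimise `C(d)`.

## References

* M. Aizenman, H. Duminil-Copin, Ann. of Math. 194 (2021) 163–235 = arXiv:1912.07973, Thm 5.6,
  Prop. 5.4, Cor. 5.5, (5.12), proof of Thm 5.6 (p. 17–20) [AizenmanDuminilCopinAnnals2021].
* M. Aizenman, H. Duminil-Copin, V. Sidoravicius, Comm. Math. Phys. 334 (2015), §3.3 (3.18),
  Thm 1.2 [AizenmanDuminilCopinSidoraviciusCMP2015].
* S. Friedli, Y. Velenik (2017), Exercise 3.14 [FriedliVelenik2017].
-/

noncomputable section

open Finset Filter Topology MeasureTheory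

namespace Literature.Probability.LatticeModels

/-! ### Part 1. Pointwise bounds on `Ŝ_β`: killing coordinates, scaling, merging -/

section Pointwise

variable {d'' : ℕ}

local notation "dd" => d'' + 2

/-- **Killing a coordinate increases `Ŝ`**: `Ŝ(p) ≤ Ŝ(p with p_j := 0)` (ADC Prop. 5.4 (i) with
`cos p_j ≤ cos 0`). [cite: AizenmanDuminilCopinAnnals2021, arXiv:1912.07973 Prop. 5.4 (i) (p. 18)] -/
theorem twoPointPlusFourier_le_update_zero {β : ℝ} (hβ : 0 ≤ β) (hβc : β < criticalBeta dd)
    (p : Fin dd → ℝ) (j : Fin dd) :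
    twoPointPlusFourier dd β p ≤ twoPointPlusFourier dd β (Function.update p j 0) := by
  have key := twoPointPlusFourier_update_le_of_cos_le (d' := d'' + 1) (by omega) hβ hβc (Function.update p j 0) j
    (q := p j) (by rw [Function.update_self, Real.cos_zero]; exact Real.cos_le_one _)
  rwa [Function.update_idem, Function.update_eq_self] at key

/-- Zeroing out a set of coordinates. [folklore] -/
def zeroOut (s : Finset (Fin dd)) (p : Fin dd → ℝ) : Fin dd → ℝ := fun i => if i ∈ s then 0 else p i

/-- **Killing several coordinates increases `Ŝ`.** [cite: AizenmanDuminilCopinAnnals2021, arXiv:1912.07973 Prop. 5.4 (i) (p. 18)] -/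
theorem twoPointPlusFourier_le_zeroOut {β : ℝ} (hβ : 0 ≤ β) (hβc : β < criticalBeta dd)
    (p : Fin dd → ℝ) (s : Finset (Fin dd)) :
    twoPointPlusFourier dd β p ≤ twoPointPlusFourier dd β (zeroOut s p) := by
  classical
  induction s using Finset.induction_on with
  | empty =>
    have : zeroOut ∅ p = p := by funext i; simp [zeroOut]
    rw [this]
  | insert j s hj ih =>
    refine ih.trans ?_
    have : zeroOut (insert j s) p = Function.update (zeroOut s p) j 0 := by
      funext i
      by_cases hi : i = j
      · subst hi; simp [zeroOut]
      · rw [Function.update_of_ne hi]; simp [zeroOut, hi]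
    rw [this]
    exact twoPointPlusFourier_le_update_zero hβ hβc _ j

/-- **`Ŝ(p) ≤ Ŝ(p_j e_j)`**: kill all coordinates but `j`. [cite: AizenmanDuminilCopinAnnals2021, arXiv:1912.07973 Prop. 5.4 (i) (p. 18)] -/
theorem twoPointPlusFourier_le_single {β : ℝ} (hβ : 0 ≤ β) (hβc : β < criticalBeta dd)
    (p : Fin dd → ℝ) (j : Fin dd) :
    twoPointPlusFourier dd β p ≤ twoPointPlusFourier dd β (Pi.single j (p j)) := by
  classical
  have := twoPointPlusFourier_le_zeroOut hβ hβc p (Finset.univ.erase j)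
  convert this using 2
  funext i
  by_cases hi : i = j
  · subst hi; simp [zeroOut]
  · simp [zeroOut, hi]

/-- **`Ŝ(m e_j) = Ŝ(|m| e₀)`** (permutation symmetry and evenness). [folklore] -/
theorem twoPointPlusFourier_single_eq (β : ℝ) (j : Fin dd) (m : ℝ) :
    twoPointPlusFourier dd β (Pi.single j m) = twoPointPlusFourier dd β (Pi.single 0 |m|) := by
  classical
  -- move `j` to `0`
  have h1 : twoPointPlusFourier dd β (Pi.single j m) = twoPointPlusFourier dd β (Pi.single 0 m) := by
    have : (Pi.single j m : Fin dd → ℝ) = (Pi.single 0 m : Fin dd → ℝ) ∘ Equiv.swap 0 j := by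
      funext i
      simp only [Function.comp_apply]
      by_cases hi : i = j
      · subst hi; simp
      · rw [Pi.single_eq_of_ne hi]
        by_cases hi0 : i = 0
        · subst hi0
          rw [Equiv.swap_apply_left, Pi.single_eq_of_ne (Ne.symm hi)]
        · rw [Equiv.swap_apply_of_ne_of_ne hi0 hi, Pi.single_eq_of_ne hi0]
    rw [this, twoPointPlusFourier_comp_perm]
  rw [h1]
  rcases le_or_gt 0 m with hm | hm
  · rw [abs_of_nonneg hm]
  · rw [abs_of_neg hm]
    have := twoPointPlusFourier_update_neg β (Pi.single 0 m : Fin dd → ℝ) 0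
    rw [Pi.single_eq_same] at this
    rw [← this]
    congr 1
    funext i
    by_cases hi : i = 0
    · subst hi; simp
    · rw [Function.update_of_ne hi, Pi.single_eq_of_ne hi, Pi.single_eq_of_ne hi]

/-- **Scaling in one coordinate via ADC Prop. 5.4 (ii)**: for `0 ≤ m ≤ M ≤ π`,
`(1 - cos m) Ŝ(m e₀) ≤ (1 - cos M) Ŝ(M e₀)`. [cite: AizenmanDuminilCopinAnnals2021, arXiv:1912.07973 Prop. 5.4 (ii) (p. 18)] -/
theorem one_sub_cos_mul_twoPointPlusFourier_single_le {β : ℝ} (hβ : 0 ≤ β) (hβc : β < criticalBeta dd)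
    {m M : ℝ} (hm : 0 ≤ m) (hmM : m ≤ M) (hM : M ≤ Real.pi) :
    (1 - Real.cos m) * twoPointPlusFourier dd β (Pi.single 0 m) ≤
      (1 - Real.cos M) * twoPointPlusFourier dd β (Pi.single 0 M) := by
  have key := one_sub_cos_mul_twoPointPlusFourier_le (d' := d'' + 1) (by omega) hβ hβc (Pi.single 0 m : Fin dd → ℝ) 0
    (q := M) (by rw [Pi.single_eq_same]; exact Real.cos_le_cos_of_nonneg_of_le_pi hm hM hmM)
  rw [Pi.single_eq_same] at key
  have hupd : (Function.update (Pi.single 0 m : Fin dd → ℝ) 0 M) = Pi.single 0 M := by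
    funext i
    by_cases hi : i = 0
    · subst hi; simp
    · rw [Function.update_of_ne hi, Pi.single_eq_of_ne hi, Pi.single_eq_of_ne hi]
  rw [hupd] at key
  exact key

/-- `1 - cos u ≥ 2u²/π²` for `|u| ≤ π` (Jordan; local copy — the tree's other copy lives in a
long-range barrier file with heavy imports). [folklore] -/
private theorem jordan_one_sub_cos {u : ℝ} (hu : |u| ≤ Real.pi) : 2 * u ^ 2 / Real.pi ^ 2 ≤ 1 - Real.cos u := by
  -- `1 - cos u = 2 sin²(u/2) ≥ 2 (u/π)²`
  have hsin : |u| / Real.pi ≤ |Real.sin (u / 2)| := by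
    wlog h0 : 0 ≤ u generalizing u
    · have := this (u := -u) (by rwa [abs_neg]) (by linarith)
      rwa [abs_neg, neg_div, Real.sin_neg, abs_neg] at this
    rw [abs_of_nonneg h0] at hu ⊢
    have h1 : 2 / Real.pi * (u / 2) ≤ Real.sin (u / 2) := Real.mul_le_sin (by linarith) (by linarith)
    rw [show 2 / Real.pi * (u / 2) = u / Real.pi by ring] at h1
    exact h1.trans (le_abs_self _)
  have h2 : (|u| / Real.pi) ^ 2 ≤ |Real.sin (u / 2)| ^ 2 := pow_le_pow_left₀ (by positivity) hsin 2
  rw [div_pow, sq_abs, sq_abs] at h2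
  have h3 : 1 - Real.cos u = 2 * Real.sin (u / 2) ^ 2 := by
    have := Real.cos_sq (u / 2)  -- cos²(u/2) = 1/2 + cos(2·(u/2))/2
    rw [show 2 * (u / 2) = u by ring] at this
    nlinarith [Real.sin_sq_add_cos_sq (u / 2)]
  rw [h3]
  have hπ : 0 < Real.pi ^ 2 := by positivity
  rw [div_le_iff₀ hπ] at h2 ⊢
  nlinarith

/-- **Scaling bound**: for `0 < m ≤ M ≤ π`, `Ŝ(m e₀) ≤ (π²/4)(M/m)² Ŝ(M e₀)`. [cite: AizenmanDuminilCopinAnnals2021, arXiv:1912.07973 Prop. 5.4 (ii) and proof of Thm 5.6 (p. 18–20)] -/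
theorem twoPointPlusFourier_single_le_scale {β : ℝ} (hβ : 0 ≤ β) (hβc : β < criticalBeta dd)
    {m M : ℝ} (hm : 0 < m) (hmM : m ≤ M) (hM : M ≤ Real.pi) :
    twoPointPlusFourier dd β (Pi.single 0 m) ≤
      Real.pi ^ 2 / 4 * (M / m) ^ 2 * twoPointPlusFourier dd β (Pi.single 0 M) := by
  have key := one_sub_cos_mul_twoPointPlusFourier_single_le hβ hβc hm.le hmM hM
  have hlow : 2 * m ^ 2 / Real.pi ^ 2 ≤ 1 - Real.cos m :=
    jordan_one_sub_cos (by rw [abs_of_pos hm]; linarith)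
  have hup : 1 - Real.cos M ≤ M ^ 2 / 2 := by linarith [Real.one_sub_sq_div_two_le_cos (x := M)]
  have hS0 : 0 ≤ twoPointPlusFourier dd β (Pi.single 0 M) := twoPointPlusFourier_nonneg (d' := d'' + 1) (by omega) hβ hβc _
  have hS0' : 0 ≤ twoPointPlusFourier dd β (Pi.single 0 m) := twoPointPlusFourier_nonneg (d' := d'' + 1) (by omega) hβ hβc _
  have hpos : 0 < 2 * m ^ 2 / Real.pi ^ 2 := by positivity
  -- `Ŝ(m) ≤ (1 - cos M)/(1 - cos m) Ŝ(M) ≤ (M²/2)/(2m²/π²) Ŝ(M)`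
  have h1 : (2 * m ^ 2 / Real.pi ^ 2) * twoPointPlusFourier dd β (Pi.single 0 m) ≤ (M ^ 2 / 2) * twoPointPlusFourier dd β (Pi.single 0 M) :=
    calc (2 * m ^ 2 / Real.pi ^ 2) * twoPointPlusFourier dd β (Pi.single 0 m)
        ≤ (1 - Real.cos m) * twoPointPlusFourier dd β (Pi.single 0 m) := mul_le_mul_of_nonneg_right hlow hS0'
      _ ≤ (1 - Real.cos M) * twoPointPlusFourier dd β (Pi.single 0 M) := key
      _ ≤ (M ^ 2 / 2) * twoPointPlusFourier dd β (Pi.single 0 M) := mul_le_mul_of_nonneg_right hup hS0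
  have hm2 : 0 < m ^ 2 := by positivity
  have hπ2 : 0 < Real.pi ^ 2 := by positivity
  -- divide `h1` by `2m²/π²`
  have h2 : twoPointPlusFourier dd β (Pi.single 0 m) ≤ (M ^ 2 / 2) / (2 * m ^ 2 / Real.pi ^ 2) * twoPointPlusFourier dd β (Pi.single 0 M) := by
    rw [div_mul_eq_mul_div, le_div_iff₀ hpos]
    linarith
  refine h2.trans (le_of_eq ?_)
  field_simp
  ring

/-- Merging a set `s ∌ 0` of coordinates into coordinate `0`. [folklore] -/
def mergeInto (s : Finset (Fin dd)) (q : Fin dd → ℝ) : Fin dd → ℝ :=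
  fun i => if i = 0 then q 0 + ∑ j ∈ s, q j else if i ∈ s then 0 else q i

/-- **The merging bound in coordinates `(0, j)`** (transport of `twoPointPlusFourier_merge_le` by
the transposition `1 ↔ j`). [cite: AizenmanDuminilCopinAnnals2021, arXiv:1912.07973 Cor. 5.5 and proof of Thm 5.6 (p. 18–20)] -/
theorem twoPointPlusFourier_merge_le' {β : ℝ} (hβ : 0 < β) (hβc : β < criticalBeta dd)
    (r : Fin dd → ℝ) {j : Fin dd} (hj : j ≠ 0) (h0 : 0 ≤ r 0) (h1 : 0 ≤ r j)
    (h0' : r 0 ≤ Real.pi / 2) (h1' : r j ≤ Real.pi / 2) :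
    twoPointPlusFourier dd β (Function.update (Function.update r 0 (r 0 + r j)) j 0) ≤
      twoPointPlusFourier dd β r + 1 / (4 * β) := by
  classical
  set σ : Equiv.Perm (Fin dd) := Equiv.swap 1 j with hσ
  set r' : Fin dd → ℝ := r ∘ σ with hr'
  have hσ0 : σ 0 = 0 := by
    rw [hσ, Equiv.swap_apply_of_ne_of_ne (by simp) (Ne.symm hj)]
  have hr'0 : r' 0 = r 0 := by simp only [hr', Function.comp_apply, hσ0]
  have hr'1 : r' 1 = r j := by simp only [hr', Function.comp_apply, hσ, Equiv.swap_apply_left]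
  have key := twoPointPlusFourier_merge_le hβ hβc r' (by rw [hr'0]; exact h0) (by rw [hr'1]; exact h1)
    (by rw [hr'0]; exact h0') (by rw [hr'1]; exact h1')
  rw [hr'0, hr'1] at key
  have hperm : twoPointPlusFourier dd β r' = twoPointPlusFourier dd β r := by
    rw [hr', twoPointPlusFourier_comp_perm]
  have hupd : (Function.update (Function.update r' 0 (r 0 + r j)) 1 0 : Fin dd → ℝ) =
      (Function.update (Function.update r 0 (r 0 + r j)) j 0) ∘ σ := by
    funext i
    simp only [Function.comp_apply]
    by_cases hi1 : i = 1
    · subst hi1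
      rw [Function.update_self, hσ, Equiv.swap_apply_left, Function.update_self]
    · rw [Function.update_of_ne hi1]
      by_cases hi0 : i = 0
      · subst hi0
        rw [Function.update_self, hσ0, Function.update_of_ne (Ne.symm hj), Function.update_self]
      · rw [Function.update_of_ne hi0, hr', Function.comp_apply]
        have hσi : σ i ≠ j := by
          intro h
          have : i = σ.symm j := by rw [← h, Equiv.symm_apply_apply]
          rw [hσ, Equiv.symm_swap, Equiv.swap_apply_right] at this
          exact hi1 this
        have hσi0 : σ i ≠ 0 := by
          intro h
          have : i = σ.symm 0 := by rw [← h, Equiv.symm_apply_apply]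
          rw [hσ, Equiv.symm_swap, Equiv.swap_apply_of_ne_of_ne (by simp) (Ne.symm hj)] at this
          exact hi0 this
        rw [Function.update_of_ne hσi, Function.update_of_ne hσi0]
  rw [hupd, twoPointPlusFourier_comp_perm, hperm] at key
  exact key

/-- **The merging chain**: for `q ≥ 0` with `∑ᵢ qᵢ ≤ π/2` and `s ∌ 0`,
`Ŝ(mergeInto s q) ≤ Ŝ(q) + |s|/(4β)`. [cite: AizenmanDuminilCopinAnnals2021, arXiv:1912.07973 Cor. 5.5 and proof of Thm 5.6 (p. 18–20)] -/
theorem twoPointPlusFourier_mergeInto_le {β : ℝ} (hβ : 0 < β) (hβc : β < criticalBeta dd)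
    {q : Fin dd → ℝ} (hq : ∀ i, 0 ≤ q i) (hsum : ∑ i, q i ≤ Real.pi / 2) (s : Finset (Fin dd)) (hs : (0 : Fin dd) ∉ s) :
    twoPointPlusFourier dd β (mergeInto s q) ≤ twoPointPlusFourier dd β q + s.card / (4 * β) := by
  classical
  induction s using Finset.induction_on with
  | empty =>
    have : mergeInto ∅ q = q := by
      funext i; by_cases hi : i = 0 <;> simp [mergeInto, hi]
    simp [this]
  | insert j s hjs ih =>
    have hj0 : j ≠ 0 := fun h => hs (h ▸ Finset.mem_insert_self j s)
    have hs0 : (0 : Fin dd) ∉ s := fun h => hs (Finset.mem_insert_of_mem h)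
    have ih' := ih hs0
    set r := mergeInto s q with hr
    -- `mergeInto (insert j s) q = update (update r 0 (r 0 + r j)) j 0`
    have hrj : r j = q j := by simp [hr, mergeInto, hj0, hjs]
    have hr0 : r 0 = q 0 + ∑ i ∈ s, q i := by simp [hr, mergeInto]
    have hstep : mergeInto (insert j s) q = Function.update (Function.update r 0 (r 0 + r j)) j 0 := by
      funext i
      by_cases hij : i = j
      · subst hij
        rw [Function.update_self]
        simp [mergeInto, hj0]
      · rw [Function.update_of_ne hij]
        by_cases hi0 : i = 0
        · subst hi0
          rw [Function.update_self, hr0, hrj]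
          simp only [mergeInto, if_true, Finset.sum_insert hjs]
          ring
        · rw [Function.update_of_ne hi0]
          simp [mergeInto, hr, hi0, hij]
    rw [hstep]
    -- hypotheses of the merging bound: partial sums stay in `[0, π/2]`
    have hpartial : q 0 + ∑ i ∈ s, q i + q j ≤ Real.pi / 2 := by
      have h1 : q 0 + ∑ i ∈ s, q i + q j = ∑ i ∈ insert 0 (insert j s), q i := by
        rw [Finset.sum_insert (by simp [hj0.symm, hs0]), Finset.sum_insert hjs]; ring
      rw [h1]
      exact (Finset.sum_le_univ_sum_of_nonneg fun i => hq i).trans hsum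
    have hsn : 0 ≤ ∑ i ∈ s, q i := Finset.sum_nonneg fun i _ => hq i
    have key := twoPointPlusFourier_merge_le' hβ hβc r hj0 (by rw [hr0]; linarith [hq 0]) (by rw [hrj]; exact hq j)
      (by rw [hr0]; linarith [hq j]) (by rw [hrj]; linarith [hq 0])
    refine key.trans ?_
    rw [Finset.card_insert_of_notMem hjs]
    push_cast
    have : (s.card : ℝ) / (4 * β) + 1 / (4 * β) = (s.card + 1) / (4 * β) := by field_simp
    linarith

/-- **Merging everything into the first coordinate**: for `q ≥ 0` with `∑ᵢ qᵢ ≤ π/2`,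
`Ŝ((∑ᵢ qᵢ) e₀) ≤ Ŝ(q) + (d-1)/(4β)` (the lower bound behind ADC Cor. 5.5, in Fourier form).
[cite: AizenmanDuminilCopinAnnals2021, arXiv:1912.07973 Cor. 5.5 and proof of Thm 5.6 (p. 18–20)] -/
theorem twoPointPlusFourier_single_sum_le {β : ℝ} (hβ : 0 < β) (hβc : β < criticalBeta dd)
    {q : Fin dd → ℝ} (hq : ∀ i, 0 ≤ q i) (hsum : ∑ i, q i ≤ Real.pi / 2) :
    twoPointPlusFourier dd β (Pi.single 0 (∑ i, q i)) ≤ twoPointPlusFourier dd β q + (d'' + 1 : ℕ) / (4 * β) := by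
  classical
  have key := twoPointPlusFourier_mergeInto_le hβ hβc hq hsum (Finset.univ.erase 0) (by simp)
  have hcard : ((Finset.univ.erase (0 : Fin dd)).card : ℝ) = (d'' + 1 : ℕ) := by
    rw [Finset.card_erase_of_mem (Finset.mem_univ _), Finset.card_univ, Fintype.card_fin]
    push_cast; ring
  have hmerge : mergeInto (Finset.univ.erase 0) q = Pi.single 0 (∑ i, q i) := by
    funext i
    by_cases hi : i = 0
    · subst hi
      simp only [mergeInto, if_true, Pi.single_eq_same]
      rw [← Finset.add_sum_erase _ _ (Finset.mem_univ 0)]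
    · simp [mergeInto, hi]
  rw [hmerge, hcard] at key
  exact key

/-- **Sign-flip invariance of `Ŝ`**: `Ŝ(ε·p) = Ŝ(p)` for signs `εᵢ = ±1` (`⟨σ₀σ_x⟩⁺` is invariant
under coordinate reflections). [cite: FriedliVelenik2017, Exercise 3.14] -/
theorem twoPointPlusFourier_signFlip {d : ℕ} (β : ℝ) (ε : Fin d → ℤˣ) (p : Fin d → ℝ) :
    twoPointPlusFourier d β (fun i => (ε i : ℤ) * p i) = twoPointPlusFourier d β p := by
  unfold twoPointPlusFourier
  rw [← Equiv.tsum_eq (Site.signedPerm (Equiv.refl _) ε)]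
  refine tsum_congr fun x => ?_
  rw [twoPointPlus_signedPerm]
  congr 1
  unfold phase
  refine congrArg Real.cos (Finset.sum_congr rfl fun i _ => ?_)
  simp only [Site.signedPerm_apply, Equiv.refl_symm, Equiv.refl_apply]
  have hε : ((ε i : ℤ) : ℝ) ^ 2 = 1 := by
    rcases Int.units_eq_one_or (ε i) with h | h <;> simp [h]
  push_cast
  linear_combination (p i * (x i : ℝ)) * hε

/-- **`Ŝ(|p|) = Ŝ(p)`** (coordinatewise absolute values). [cite: FriedliVelenik2017, Exercise 3.14] -/
theorem twoPointPlusFourier_abs {d : ℕ} (β : ℝ) (p : Fin d → ℝ) :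
    twoPointPlusFourier d β (fun i => |p i|) = twoPointPlusFourier d β p := by
  set ε : Fin d → ℤˣ := fun i => if 0 ≤ p i then 1 else -1 with hε
  have : (fun i => |p i|) = fun i => (ε i : ℤ) * p i := by
    funext i
    by_cases h : 0 ≤ p i
    · simp [hε, h, abs_of_nonneg h]
    · push Not at h
      simp [hε, not_le.2 h, abs_of_neg h]
  rw [this, twoPointPlusFourier_signFlip]

/-- **The region-A bound** (ADC, proof of Thm 5.6, "by (5.17)": on the small momenta,
`Ŝ(p) ≤ (π²/4) d² λ² [Ŝ(λp) + (d-1)/(4β)]` whenever `p ≠ 0`, `|pᵢ| ≤ π` and `λ ∑ᵢ|pᵢ| ≤ π/2`). Chain: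
kill all coordinates but the largest (Prop. 5.4 (i)), scale it from `‖p‖_∞` to `λ ∑|pᵢ|`
(Prop. 5.4 (ii)), and un-merge (Prop. 5.4 (iii) / Cor. 5.5). [cite: AizenmanDuminilCopinAnnals2021, arXiv:1912.07973 proof of Thm 5.6 (p. 19–20)] -/
theorem twoPointPlusFourier_le_regionA {β : ℝ} (hβ : 0 < β) (hβc : β < criticalBeta dd)
    {p : Fin dd → ℝ} (hp0 : p ≠ 0) {lam : ℝ} (hlam : 1 ≤ lam)
    (hA : lam * ∑ i, |p i| ≤ Real.pi / 2) :
    twoPointPlusFourier dd β p ≤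
      Real.pi ^ 2 / 4 * ((dd : ℕ) * lam) ^ 2 *
        (twoPointPlusFourier dd β (fun i => lam * p i) + (d'' + 1 : ℕ) / (4 * β)) := by
  classical
  -- the largest coordinate
  obtain ⟨j, -, hj⟩ := Finset.exists_max_image Finset.univ (fun i => |p i|) Finset.univ_nonempty
  set m := |p j| with hm
  set M := lam * ∑ i, |p i| with hM
  have hsum_nonneg : 0 ≤ ∑ i, |p i| := Finset.sum_nonneg fun i _ => abs_nonneg _
  have hm0 : 0 < m := by
    by_contra hle
    push Not at hle
    apply hp0
    funext i
    have := (hj i (Finset.mem_univ i)).trans hle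
    exact abs_nonpos_iff.1 this
  have hmle : m ≤ ∑ i, |p i| := Finset.single_le_sum (fun i _ => abs_nonneg (p i)) (Finset.mem_univ j)
  have hmM : m ≤ M := hmle.trans (le_mul_of_one_le_left hsum_nonneg hlam)
  have hMπ : M ≤ Real.pi := hA.trans (by linarith [Real.pi_pos])
  have hsum_le : ∑ i, |p i| ≤ (dd : ℕ) * m := by
    calc ∑ i, |p i| ≤ ∑ _i : Fin dd, m := Finset.sum_le_sum fun i _ => hj i (Finset.mem_univ i)
      _ = (dd : ℕ) * m := by simp
  have hratio : (M / m) ^ 2 ≤ ((dd : ℕ) * lam) ^ 2 := by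
    refine pow_le_pow_left₀ (by positivity) ?_ 2
    rw [div_le_iff₀ hm0, hM]
    calc lam * ∑ i, |p i| ≤ lam * ((dd : ℕ) * m) := mul_le_mul_of_nonneg_left hsum_le (by linarith)
      _ = (dd : ℕ) * lam * m := by ring
  -- the chain
  have h1 : twoPointPlusFourier dd β p ≤ twoPointPlusFourier dd β (Pi.single 0 m) := by
    rw [hm, ← twoPointPlusFourier_single_eq β j (p j)]
    exact twoPointPlusFourier_le_single hβ.le hβc p j
  have h2 := twoPointPlusFourier_single_le_scale hβ.le hβc hm0 hmM hMπ
  have h3 : twoPointPlusFourier dd β (Pi.single 0 M) ≤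
      twoPointPlusFourier dd β (fun i => lam * p i) + (d'' + 1 : ℕ) / (4 * β) := by
    have key := twoPointPlusFourier_single_sum_le hβ hβc (q := fun i => lam * |p i|)
      (fun i => by positivity) (by rw [← Finset.mul_sum]; exact hA)
    rw [← Finset.mul_sum] at key
    refine key.trans ?_
    have : twoPointPlusFourier dd β (fun i => lam * |p i|) = twoPointPlusFourier dd β (fun i => lam * p i) := by
      rw [← twoPointPlusFourier_abs β (fun i => lam * p i)]
      congr 1
      funext i
      rw [abs_mul, abs_of_nonneg (by linarith : (0 : ℝ) ≤ lam)]
    rw [this]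
  have hS0 : 0 ≤ twoPointPlusFourier dd β (Pi.single 0 M) := twoPointPlusFourier_nonneg (d' := d'' + 1) (by omega) hβ.le hβc _
  calc twoPointPlusFourier dd β p ≤ twoPointPlusFourier dd β (Pi.single 0 m) := h1
    _ ≤ Real.pi ^ 2 / 4 * (M / m) ^ 2 * twoPointPlusFourier dd β (Pi.single 0 M) := h2
    _ ≤ Real.pi ^ 2 / 4 * ((dd : ℕ) * lam) ^ 2 * twoPointPlusFourier dd β (Pi.single 0 M) := by gcongr
    _ ≤ _ := by gcongr

/-- **The region-B bound** (the infrared bound off the small momenta): if some `|p_j| > π/(2dλ)`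
with `|p_j| ≤ π`, then `Ŝ(p) ≤ d²λ²/β`. [cite: AizenmanDuminilCopinAnnals2021, arXiv:1912.07973 (5.12) and proof of Thm 5.6 (p. 17, 19–20)] -/
theorem twoPointPlusFourier_le_regionB {β : ℝ} (hβ : 0 < β) (hβc : β < criticalBeta dd)
    {p : Fin dd → ℝ} {lam : ℝ} (hlam : 1 ≤ lam) {j : Fin dd}
    (hj : Real.pi / (2 * (dd : ℕ) * lam) < |p j|) (hjπ : |p j| ≤ Real.pi) :
    twoPointPlusFourier dd β p ≤ ((dd : ℕ) : ℝ) ^ 2 * lam ^ 2 / β := by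
  have hd : (0 : ℝ) < (dd : ℕ) := by positivity
  set a := Real.pi / (2 * (dd : ℕ) * lam) with ha
  have hapos : 0 < a := by positivity
  -- `ℰ(p) ≥ 1 - cos p_j ≥ 2 p_j²/π² > 2a²/π²`
  have hE1 : 2 * (p j) ^ 2 / Real.pi ^ 2 ≤ 1 - Real.cos (p j) := jordan_one_sub_cos hjπ
  have hEj : 1 - Real.cos (p j) ≤ dispersion p := by
    unfold dispersion
    exact Finset.single_le_sum (f := fun i => 1 - Real.cos (p i)) (fun i _ => by linarith [Real.cos_le_one (p i)])
      (Finset.mem_univ j)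
  have ha2 : 2 * a ^ 2 / Real.pi ^ 2 < 2 * (p j) ^ 2 / Real.pi ^ 2 := by
    have : a ^ 2 < (p j) ^ 2 := by
      rw [← sq_abs (p j)]
      exact pow_lt_pow_left₀ hj hapos.le (by norm_num)
    have hπ2 : 0 < Real.pi ^ 2 := by positivity
    exact div_lt_div_of_pos_right (by linarith) hπ2
  have hEpos : 0 < dispersion p := by
    have : 0 < 2 * a ^ 2 / Real.pi ^ 2 := by positivity
    linarith
  refine (twoPointPlusFourier_le_infrared (d' := d'' + 1) (by omega) hβ hβc hEpos).trans ?_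
  -- `1/(2βℰ) ≤ d²λ²/β` iff `1 ≤ 2ℰ d²λ²`, and `2ℰ ≥ 4a²/π² = 1/(d²λ²)`
  have hE : 2 * a ^ 2 / Real.pi ^ 2 ≤ dispersion p := by linarith
  have hkey : 1 ≤ 2 * dispersion p * (((dd : ℕ) : ℝ) ^ 2 * lam ^ 2) := by
    have e : 2 * (2 * a ^ 2 / Real.pi ^ 2) * (((dd : ℕ) : ℝ) ^ 2 * lam ^ 2) = 1 := by
      rw [ha]; field_simp
    rw [← e]
    gcongr
  rw [div_le_div_iff₀ (by positivity) hβ]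
  nlinarith [hkey, hβ]

end Pointwise

/-! ### Part 2. The grid estimate: `χ^F_{λℓ} ≤ C_d (λ²/β) χ^F_ℓ` -/

section Grid

variable {d'' : ℕ}

local notation "dd" => d'' + 2

variable (d'') in
/-- The **Fejér-weighted susceptibility** `χ^F_L = ∑_x F_L(x) S(x)`. [folklore] -/
def fejerSusc (β : ℝ) (L : ℕ) : ℝ := ∑ x ∈ box dd L, fejerBox dd L x * twoPointPlus dd β x

/-- `χ^F_L ≥ 1` (`F_L(0) S(0) = 1`, all terms nonnegative). [folklore] -/
theorem one_le_fejerSusc {β : ℝ} (hβ : 0 ≤ β) {L : ℕ} (hL : 1 ≤ L) : 1 ≤ fejerSusc d'' β L := by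
  unfold fejerSusc
  have h0 : (0 : Site dd) ∈ box dd L := zero_mem_box dd L
  rw [← Finset.add_sum_erase _ _ h0, fejerBox_zero hL, twoPointPlus_zero, mul_one]
  refine le_add_of_nonneg_right (Finset.sum_nonneg fun x _ => mul_nonneg (fejerBox_nonneg _ _) (twoPointPlus_nonneg_of_gks hβ _))

/-- The Fejér kernel is `2π`-periodic. [folklore] -/
theorem fejerKernel_add_int_mul_two_pi (L : ℕ) (u : ℝ) (m : ℤ) : fejerKernel L (u + m * (2 * Real.pi)) = fejerKernel L u := by
  unfold fejerKernel dirichletSum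
  congr 3
  refine Finset.sum_congr rfl fun n _ => ?_
  rw [show ((n : ℝ) : ℂ) * ((u + m * (2 * Real.pi) : ℝ) : ℂ) * Complex.I =
      ((n : ℝ) : ℂ) * u * Complex.I + ((n * m : ℤ) : ℂ) * (2 * Real.pi * Complex.I) by push_cast; ring,
    Complex.exp_add, Complex.exp_int_mul_two_pi_mul_I, mul_one]

/-- `F̂_L(p') = F̂_L(p)` if `p' - p ∈ 2πℤ^d`. [folklore] -/
theorem fejerBoxHat_eq_of_sub_mem {d : ℕ} (L : ℕ) {p p' : Fin d → ℝ} (h : ∀ i, ∃ m : ℤ, p' i = p i + m * (2 * Real.pi)) :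
    fejerBoxHat d L p' = fejerBoxHat d L p := by
  unfold fejerBoxHat
  refine Finset.prod_congr rfl fun i _ => ?_
  obtain ⟨m, hm⟩ := h i
  rw [hm, fejerKernel_add_int_mul_two_pi]

variable {Λ : ℕ} [NeZero Λ]

/-- The **centred grid momentum** `p̃_k = 2π rep(k)/Λ ∈ (-π, π]^d`. [folklore] -/
def centredMomentum (Λ : ℕ) [NeZero Λ] {d : ℕ} (k : TorusSite d Λ) : Fin d → ℝ :=
  fun i => 2 * Real.pi * (Torus.rep k i : ℝ) / Λ

/-- `|p̃_{k,i}| ≤ π`. [folklore] -/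
theorem abs_centredMomentum_le {d : ℕ} (k : TorusSite d Λ) (i : Fin d) : |centredMomentum Λ k i| ≤ Real.pi := by
  have hmem := (mem_centredCube.1 (Torus.rep_mem_centredCube k)) i
  have hΛ : (0 : ℝ) < Λ := by exact_mod_cast Nat.pos_of_ne_zero (NeZero.ne Λ)
  unfold centredMomentum
  rw [abs_div, abs_of_pos hΛ, div_le_iff₀ hΛ, abs_mul, abs_of_pos (by positivity : (0 : ℝ) < 2 * Real.pi)]
  have h1 : (2 * |(Torus.rep k i : ℝ)| : ℝ) ≤ Λ := by
    have : 2 * |Torus.rep k i| ≤ (Λ : ℤ) := by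
      rcases le_or_gt 0 (Torus.rep k i) with h | h
      · rw [abs_of_nonneg h]; linarith [hmem.2]
      · rw [abs_of_neg h]; linarith [hmem.1]
    have h2 : ((2 * |Torus.rep k i| : ℤ) : ℝ) ≤ ((Λ : ℤ) : ℝ) := by exact_mod_cast this
    push_cast at h2
    exact h2
  nlinarith [Real.pi_pos, abs_nonneg (Torus.rep k i : ℝ)]

/-- `p̃_k ≡ p_k (mod 2πℤ^d)`. [folklore] -/
theorem centredMomentum_sub_mem {d : ℕ} (k : TorusSite d Λ) (i : Fin d) :
    ∃ m : ℤ, centredMomentum Λ k i = latticeMomentum Λ k i + m * (2 * Real.pi) := by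
  have hΛ : (Λ : ℝ) ≠ 0 := by exact_mod_cast NeZero.ne Λ
  unfold centredMomentum latticeMomentum Torus.rep
  split_ifs with h
  · exact ⟨0, by push_cast; ring⟩
  · exact ⟨-1, by push_cast; field_simp; ring⟩

/-- `k ≠ 0 → p̃_k ≠ 0`. [folklore] -/
theorem centredMomentum_ne_zero {d : ℕ} {k : TorusSite d Λ} (hk : k ≠ 0) : centredMomentum Λ k ≠ 0 := by
  intro h
  apply hk
  have hrep : Torus.rep k = 0 := by
    funext i
    have := congrFun h i
    unfold centredMomentum at this
    have hΛ : (Λ : ℝ) ≠ 0 := by exact_mod_cast NeZero.ne Λ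
    have h2 : (Torus.rep k i : ℝ) = 0 := by
      field_simp at this
      have hπ : Real.pi ≠ 0 := Real.pi_ne_zero
      simpa [hπ] using this
    exact_mod_cast h2
  rw [← Torus.proj_rep k, hrep]
  funext i; simp [Torus.proj_apply]

/-- **The scaled centred momentum is a grid momentum of the coarser grid**: with `Λ = λΛ'`,
`λ p̃_k ≡ p_{k'} (mod 2π)` for `k' = rep(k) mod Λ'`. [folklore] -/
theorem lam_mul_centredMomentum_sub_mem {d : ℕ} {Λ' lam : ℕ} [NeZero Λ'] (hΛ : Λ = lam * Λ') (hlam : 1 ≤ lam)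
    (k : TorusSite d Λ) (i : Fin d) :
    ∃ m : ℤ, (lam : ℝ) * centredMomentum Λ k i = latticeMomentum Λ' (Torus.proj Λ' (Torus.rep k)) i + m * (2 * Real.pi) := by
  have hΛ' : (Λ' : ℝ) ≠ 0 := by exact_mod_cast NeZero.ne Λ'
  have hlam' : (lam : ℝ) ≠ 0 := by exact_mod_cast (show lam ≠ 0 by omega)
  have hΛR : (Λ : ℝ) = lam * Λ' := by exact_mod_cast hΛ
  unfold centredMomentum latticeMomentum
  rw [Torus.proj_apply, hΛR]
  -- `(rep k i : ZMod Λ').val = rep k i mod Λ'`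
  have hv : (((Torus.rep k i : ℤ) : ZMod Λ').val : ℤ) = Torus.rep k i % Λ' := ZMod.val_intCast _
  refine ⟨Torus.rep k i / Λ', ?_⟩
  have h1 : ((((Torus.rep k i : ℤ) : ZMod Λ').val : ℕ) : ℝ) = ((Torus.rep k i % Λ' : ℤ) : ℝ) := by exact_mod_cast hv
  rw [h1, Int.emod_def]
  push_cast
  field_simp
  ring

/-- **Injectivity of `k ↦ k'` on region A**: if all `|rep(k)ᵢ|, |rep(k₂)ᵢ| < Λ'/2` and
`rep(k) ≡ rep(k₂) (mod Λ')` then `k = k₂`. [folklore] -/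
theorem eq_of_proj_rep_eq {d : ℕ} {Λ' : ℕ} [NeZero Λ'] {k k₂ : TorusSite d Λ}
    (hk : ∀ i, 2 * |Torus.rep k i| < Λ') (hk₂ : ∀ i, 2 * |Torus.rep k₂ i| < Λ')
    (h : Torus.proj Λ' (Torus.rep k) = Torus.proj Λ' (Torus.rep k₂)) : k = k₂ := by
  have h0 : Torus.proj Λ' (Torus.rep k - Torus.rep k₂) = 0 := by
    rw [show Torus.rep k - Torus.rep k₂ = Torus.rep k + -Torus.rep k₂ from sub_eq_add_neg _ _, torusProj_add, h]
    funext i; simp [Torus.proj_apply]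
  have := (torusProj_eq_zero_iff_of_abs_lt (L := Λ') (v := Torus.rep k - Torus.rep k₂) fun j => ?_).1 h0
  · have hrep : Torus.rep k = Torus.rep k₂ := sub_eq_zero.1 this
    rw [← Torus.proj_rep k, ← Torus.proj_rep k₂, hrep]
  · rw [Pi.sub_apply]
    have := abs_sub (Torus.rep k j) (Torus.rep k₂ j)
    have h1 := hk j; have h2 := hk₂ j
    linarith

end Grid

section GridEstimate

variable {d'' : ℕ}

local notation "dd" => d'' + 2

variable (d'') in
/-- The constant of the region-A bound (dimension `d = d''+2`): `(π²/4)^{d+1} d²`. [folklore] -/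
def cA : ℝ := (Real.pi ^ 2 / 4) ^ (dd + 1) * ((dd : ℕ) : ℝ) ^ 2

/-- `c_A ≥ 0`. [folklore] -/
theorem cA_nonneg : 0 ≤ cA d'' := by unfold cA; positivity

/-- **The grid inequality at finite `Λ'`** (the tree's rendering of ADC's proof of Thm 5.6 on the
momentum grid `2πk/(λΛ')`): for `0 < β < β_c`, `1 ≤ ℓ < Λ'`, `λ ≥ 1`,
`χ^F_{λℓ} ≤ (ℓ/Λ')^d Ŝ(0) + c_A λ² [∑_x F_ℓ(x) S_{Λ'}(x) + (d-1)/(4β)] + d²λ²/β`.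
[cite: AizenmanDuminilCopinAnnals2021, arXiv:1912.07973 proof of Thm 5.6 (p. 19–20)] -/
theorem fejerSusc_le_grid {β : ℝ} (hβ : 0 < β) (hβc : β < criticalBeta dd) {ℓ lam Λ' : ℕ} (hℓ : 1 ≤ ℓ)
    (hlam : 1 ≤ lam) (hℓΛ' : ℓ < Λ') :
    fejerSusc d'' β (lam * ℓ) ≤
      ((ℓ : ℝ) / Λ') ^ dd * twoPointPlusFourier dd β 0 +
        cA d'' * (lam : ℝ) ^ 2 * (∑ x ∈ box dd ℓ, fejerBox dd ℓ x * periodize dd Λ' (twoPointPlus dd β) x +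
          (d'' + 1 : ℕ) / (4 * β)) +
        ((dd : ℕ) : ℝ) ^ 2 * (lam : ℝ) ^ 2 / β := by
  classical
  haveI : NeZero Λ' := ⟨by omega⟩
  set Λ : ℕ := lam * Λ' with hΛdef
  haveI hΛ0 : NeZero Λ := ⟨by rw [hΛdef]; exact Nat.mul_ne_zero (by omega) (by omega)⟩
  have hΛ1 : 1 ≤ Λ := Nat.pos_of_ne_zero (NeZero.ne Λ)
  have hΛ'1 : 1 ≤ Λ' := by omega
  set L : ℕ := lam * ℓ with hLdef
  have hL1 : 1 ≤ L := by rw [hLdef]; exact Nat.one_le_iff_ne_zero.2 (Nat.mul_ne_zero (by omega) (by omega))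
  have hLΛ : L < Λ := by rw [hLdef, hΛdef]; exact Nat.mul_lt_mul_of_pos_left hℓΛ' (by omega)
  have hS : Summable (twoPointPlus dd β) := summable_twoPointPlus_of_lt_criticalBeta (d := dd) (by omega) hβ.le hβc
  have hS0 : ∀ y, 0 ≤ twoPointPlus dd β y := fun y => twoPointPlus_nonneg_of_gks hβ.le y
  have hSh0 : ∀ p, 0 ≤ twoPointPlusFourier dd β p := fun p => twoPointPlusFourier_nonneg (d' := d'' + 1) (by omega) hβ.le hβc p
  have hSh_per : ∀ {p p' : Fin dd → ℝ}, (∀ i, ∃ m : ℤ, p' i = p i + m * (2 * Real.pi)) →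
      twoPointPlusFourier dd β p' = twoPointPlusFourier dd β p :=
    fun h => twoPointPlusFourier_eq_of_sub_mem β h
  set c : ℝ := (d'' + 1 : ℕ) / (4 * β) with hcdef
  have hc0 : 0 ≤ c := by positivity
  -- Step 1–2: `χ^F_L ≤ ∑_x F_L S_Λ = Λ^{-d} ∑_k F̂_L(p_k) Ŝ(p_k)`
  have hstep1 : fejerSusc d'' β L ≤ ∑ x ∈ box dd L, fejerBox dd L x * periodize dd Λ (twoPointPlus dd β) x :=
    Finset.sum_le_sum fun x _ => mul_le_mul_of_nonneg_left (le_periodize hΛ1 hS hS0 x) (fejerBox_nonneg _ _)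
  have hpars : ∑ k : TorusSite dd Λ, fejerBoxHat dd L (latticeMomentum Λ k) * twoPointPlusFourier dd β (latticeMomentum Λ k) =
      (Λ : ℝ) ^ dd * ∑ x ∈ box dd L, fejerBox dd L x * periodize dd Λ (twoPointPlus dd β) x := by
    rw [← discreteParseval hΛ1 (L₀ := L) (F := fejerBox dd L) (fejerBox_neg L) hS hS0]
    refine Finset.sum_congr rfl fun k _ => ?_
    rw [fejerBoxHat_eq_sum hL1]
    rfl
  have hΛpos : (0 : ℝ) < (Λ : ℝ) ^ dd := by positivity
  -- Step 3: the pointwise bound on `T(k) = F̂_L(p_k) Ŝ(p_k)`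
  set kmap : TorusSite dd Λ → TorusSite dd Λ' := fun k => Torus.proj Λ' (Torus.rep k) with hkmap
  set G : TorusSite dd Λ' → ℝ := fun k' => fejerBoxHat dd ℓ (latticeMomentum Λ' k') * (twoPointPlusFourier dd β (latticeMomentum Λ' k') + c) with hG
  have hG0 : ∀ k', 0 ≤ G k' := fun k' => mul_nonneg (fejerBoxHat_nonneg _ _) (add_nonneg (hSh0 _) hc0)
  set inA : TorusSite dd Λ → Prop := fun k => k ≠ 0 ∧ (lam : ℝ) * ∑ i, |centredMomentum Λ k i| ≤ Real.pi / 2 with hinA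
  set CA' : ℝ := (Real.pi ^ 2 / 4 * lam) ^ dd * (Real.pi ^ 2 / 4 * ((dd : ℕ) * (lam : ℝ)) ^ 2) with hCA'
  have hCA'0 : 0 ≤ CA' := by positivity
  have hpt : ∀ k : TorusSite dd Λ, fejerBoxHat dd L (latticeMomentum Λ k) * twoPointPlusFourier dd β (latticeMomentum Λ k) ≤
      (if k = 0 then (L : ℝ) ^ dd * twoPointPlusFourier dd β 0 else 0) + CA' * (if inA k then G (kmap k) else 0) +
        ((dd : ℕ) : ℝ) ^ 2 * (lam : ℝ) ^ 2 / β * fejerBoxHat dd L (latticeMomentum Λ k) := by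
    intro k
    have hT3 : 0 ≤ ((dd : ℕ) : ℝ) ^ 2 * (lam : ℝ) ^ 2 / β * fejerBoxHat dd L (latticeMomentum Λ k) :=
      mul_nonneg (by positivity) (fejerBoxHat_nonneg _ _)
    have hT2 : 0 ≤ CA' * (if inA k then G (kmap k) else 0) := mul_nonneg hCA'0 (by split_ifs; exact hG0 _; exact le_rfl)
    by_cases hk0 : k = 0
    · -- `k = 0`
      subst hk0
      have hnot : ¬ inA 0 := fun h => h.1 rfl
      rw [if_pos rfl, if_neg hnot, mul_zero, add_zero]
      have hp0 : latticeMomentum Λ (0 : TorusSite dd Λ) = 0 := by funext i; simp [latticeMomentum]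
      rw [hp0]
      have h1 : fejerBoxHat dd L 0 * twoPointPlusFourier dd β 0 ≤ (L : ℝ) ^ dd * twoPointPlusFourier dd β 0 :=
        mul_le_mul_of_nonneg_right (fejerBoxHat_le L 0) (hSh0 0)
      have h2 : 0 ≤ ((dd : ℕ) : ℝ) ^ 2 * (lam : ℝ) ^ 2 / β * fejerBoxHat dd L 0 := mul_nonneg (by positivity) (fejerBoxHat_nonneg _ _)
      linarith
    rw [if_neg hk0, zero_add]
    -- pass to the centred momentum `p̃`
    set pt := centredMomentum Λ k with hpt
    have hper : ∀ i, ∃ m : ℤ, pt i = latticeMomentum Λ k i + m * (2 * Real.pi) := centredMomentum_sub_mem k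
    have hShp : twoPointPlusFourier dd β (latticeMomentum Λ k) = twoPointPlusFourier dd β pt := (hSh_per hper).symm
    have hFp : fejerBoxHat dd L (latticeMomentum Λ k) = fejerBoxHat dd L pt := (fejerBoxHat_eq_of_sub_mem L hper).symm
    have hptπ : ∀ i, |pt i| ≤ Real.pi := abs_centredMomentum_le k
    by_cases hAk : (lam : ℝ) * ∑ i, |pt i| ≤ Real.pi / 2
    · -- region A
      have hin : inA k := ⟨hk0, hAk⟩
      rw [if_pos hin, hShp, hFp]
      have hpt0 : pt ≠ 0 := centredMomentum_ne_zero hk0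
      have hlamR : (1 : ℝ) ≤ lam := by exact_mod_cast hlam
      have hA1 := twoPointPlusFourier_le_regionA hβ hβc hpt0 hlamR hAk
      have hF1 : fejerBoxHat dd L pt ≤ (Real.pi ^ 2 / 4 * lam) ^ dd * fejerBoxHat dd ℓ (fun i => lam * pt i) := by
        rw [hLdef]; exact fejerBoxHat_mul_le hℓ hlam hptπ
      -- `λ p̃ ≡ p_{k'}`
      have hper' : ∀ i, ∃ m : ℤ, (fun i => (lam : ℝ) * pt i) i = latticeMomentum Λ' (kmap k) i + m * (2 * Real.pi) :=
        fun i => lam_mul_centredMomentum_sub_mem (Λ := Λ) rfl hlam k i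
      have hSh' : twoPointPlusFourier dd β (fun i => lam * pt i) = twoPointPlusFourier dd β (latticeMomentum Λ' (kmap k)) := hSh_per hper'
      have hF' : fejerBoxHat dd ℓ (fun i => lam * pt i) = fejerBoxHat dd ℓ (latticeMomentum Λ' (kmap k)) :=
        fejerBoxHat_eq_of_sub_mem ℓ hper'
      rw [hSh'] at hA1
      rw [hF'] at hF1
      have hGk : G (kmap k) = fejerBoxHat dd ℓ (latticeMomentum Λ' (kmap k)) * (twoPointPlusFourier dd β (latticeMomentum Λ' (kmap k)) + c) := rfl
      calc fejerBoxHat dd L pt * twoPointPlusFourier dd β pt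
          ≤ ((Real.pi ^ 2 / 4 * lam) ^ dd * fejerBoxHat dd ℓ (latticeMomentum Λ' (kmap k))) *
              (Real.pi ^ 2 / 4 * ((dd : ℕ) * (lam : ℝ)) ^ 2 * (twoPointPlusFourier dd β (latticeMomentum Λ' (kmap k)) + c)) :=
            mul_le_mul hF1 hA1 (hSh0 _) (mul_nonneg (by positivity) (fejerBoxHat_nonneg _ _))
        _ = CA' * G (kmap k) := by rw [hGk, hCA']; ring
        _ ≤ CA' * G (kmap k) + ((dd : ℕ) : ℝ) ^ 2 * (lam : ℝ) ^ 2 / β * fejerBoxHat dd L pt := by rw [← hFp]; linarith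
    · -- region B: some coordinate is large
      have hT2' : 0 ≤ CA' * (if inA k then G (kmap k) else 0) := hT2
      obtain ⟨j, hj⟩ : ∃ j, Real.pi / (2 * (dd : ℕ) * lam) < |pt j| := by
        by_contra hcon
        push Not at hcon
        apply hAk
        have hlamR : (0 : ℝ) < lam := by exact_mod_cast (show 0 < lam by omega)
        calc (lam : ℝ) * ∑ i, |pt i| ≤ lam * ∑ _i : Fin dd, Real.pi / (2 * (dd : ℕ) * lam) :=
              mul_le_mul_of_nonneg_left (Finset.sum_le_sum fun i _ => hcon i) hlamR.le
          _ = Real.pi / 2 := by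
              rw [Finset.sum_const, Finset.card_univ, Fintype.card_fin, nsmul_eq_mul]
              field_simp
      have hB := twoPointPlusFourier_le_regionB hβ hβc (p := pt) (by exact_mod_cast hlam : (1 : ℝ) ≤ lam) hj (hptπ j)
      rw [hShp]
      calc fejerBoxHat dd L (latticeMomentum Λ k) * twoPointPlusFourier dd β pt
          ≤ fejerBoxHat dd L (latticeMomentum Λ k) * (((dd : ℕ) : ℝ) ^ 2 * (lam : ℝ) ^ 2 / β) :=
            mul_le_mul_of_nonneg_left hB (fejerBoxHat_nonneg _ _)
        _ = ((dd : ℕ) : ℝ) ^ 2 * (lam : ℝ) ^ 2 / β * fejerBoxHat dd L (latticeMomentum Λ k) := by ring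
        _ ≤ _ := by linarith
  -- Step 4: sum over the grid
  have hsumA : ∑ k : TorusSite dd Λ, (if inA k then G (kmap k) else 0) ≤ ∑ k' : TorusSite dd Λ', G k' := by
    rw [← Finset.sum_filter]
    have hinj : Set.InjOn kmap ((Finset.univ : Finset (TorusSite dd Λ)).filter inA : Set (TorusSite dd Λ)) := by
      intro k hk k₂ hk₂ h
      simp only [Finset.coe_filter, Finset.mem_univ, true_and, Set.mem_setOf_eq] at hk hk₂
      -- on `A`, `2|rep k i| < Λ'`
      have hsmall : ∀ {k : TorusSite dd Λ}, inA k → ∀ i, 2 * |Torus.rep k i| < Λ' := by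
        intro k hk i
        have h1 : (lam : ℝ) * |centredMomentum Λ k i| ≤ Real.pi / 2 :=
          (mul_le_mul_of_nonneg_left (Finset.single_le_sum (f := fun i => |centredMomentum Λ k i|)
            (fun i _ => abs_nonneg _) (Finset.mem_univ i)) (by positivity)).trans hk.2
        have hlamR : (0 : ℝ) < lam := by exact_mod_cast (show 0 < lam by omega)
        have hΛ'R : (0 : ℝ) < Λ' := by exact_mod_cast (show 0 < Λ' by omega)
        have hΛR : (Λ : ℝ) = lam * Λ' := by rw [hΛdef]; push_cast; ring
        have habs : |centredMomentum Λ k i| = 2 * Real.pi * |(Torus.rep k i : ℝ)| / (lam * Λ') := by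
          unfold centredMomentum
          rw [hΛR, abs_div, abs_mul, abs_of_pos (by positivity : (0 : ℝ) < 2 * Real.pi),
            abs_of_pos (by positivity : (0 : ℝ) < lam * Λ')]
        rw [habs] at h1
        -- `λ · 2π|r|/(λΛ') = 2π|r|/Λ' ≤ π/2` gives `4|r| ≤ Λ'`
        have h2 : 2 * Real.pi * |(Torus.rep k i : ℝ)| / Λ' ≤ Real.pi / 2 := by
          have : (lam : ℝ) * (2 * Real.pi * |(Torus.rep k i : ℝ)| / (lam * Λ')) = 2 * Real.pi * |(Torus.rep k i : ℝ)| / Λ' := by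
            field_simp
          rw [← this]; exact h1
        rw [div_le_iff₀ hΛ'R] at h2
        have h4 : 4 * |(Torus.rep k i : ℝ)| ≤ Λ' := by nlinarith [Real.pi_pos, abs_nonneg (Torus.rep k i : ℝ)]
        have h3 : ((2 * |Torus.rep k i| : ℤ) : ℝ) < Λ' := by
          push_cast
          linarith [abs_nonneg (Torus.rep k i : ℝ)]
        exact_mod_cast h3
      exact eq_of_proj_rep_eq (hsmall hk) (hsmall hk₂) h
    rw [← Finset.sum_image (g := kmap) (f := G) hinj]
    exact Finset.sum_le_sum_of_subset_of_nonneg (Finset.subset_univ _) fun k' _ _ => hG0 k'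
  have hsumF : ∑ k : TorusSite dd Λ, fejerBoxHat dd L (latticeMomentum Λ k) = (Λ : ℝ) ^ dd := sum_fejerBoxHat_torus hL1 hLΛ
  have hsum0 : ∑ k : TorusSite dd Λ, (if k = 0 then (L : ℝ) ^ dd * twoPointPlusFourier dd β 0 else 0) = (L : ℝ) ^ dd * twoPointPlusFourier dd β 0 := by
    rw [Finset.sum_ite_eq']; simp
  have hsumG : ∑ k' : TorusSite dd Λ', G k' =
      (Λ' : ℝ) ^ dd * ∑ x ∈ box dd ℓ, fejerBox dd ℓ x * periodize dd Λ' (twoPointPlus dd β) x + c * (Λ' : ℝ) ^ dd := by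
    simp only [hG, mul_add, Finset.sum_add_distrib]
    congr 1
    · rw [← discreteParseval hΛ'1 (L₀ := ℓ) (F := fejerBox dd ℓ) (fejerBox_neg ℓ) hS hS0]
      refine Finset.sum_congr rfl fun k' _ => ?_
      rw [fejerBoxHat_eq_sum hℓ]
      rfl
    · rw [← Finset.sum_mul, sum_fejerBoxHat_torus hℓ hℓΛ', mul_comm]
  -- assemble
  have htot : (Λ : ℝ) ^ dd * ∑ x ∈ box dd L, fejerBox dd L x * periodize dd Λ (twoPointPlus dd β) x ≤
      (L : ℝ) ^ dd * twoPointPlusFourier dd β 0 + CA' * ((Λ' : ℝ) ^ dd * ∑ x ∈ box dd ℓ, fejerBox dd ℓ x * periodize dd Λ' (twoPointPlus dd β) x + c * (Λ' : ℝ) ^ dd) +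
        ((dd : ℕ) : ℝ) ^ 2 * (lam : ℝ) ^ 2 / β * (Λ : ℝ) ^ dd := by
    rw [← hpars]
    refine (Finset.sum_le_sum fun k _ => hpt k).trans ?_
    rw [Finset.sum_add_distrib, Finset.sum_add_distrib, hsum0, ← Finset.mul_sum, ← Finset.mul_sum, hsumF]
    have := mul_le_mul_of_nonneg_left hsumA hCA'0
    rw [hsumG] at this
    linarith
  -- divide by `Λ^d = λ^d Λ'^d`
  have hΛR : (Λ : ℝ) = lam * Λ' := by rw [hΛdef]; push_cast; ring
  have hLR : (L : ℝ) = lam * ℓ := by rw [hLdef]; push_cast; ring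
  have hlamR : (0 : ℝ) < lam := by exact_mod_cast (show 0 < lam by omega)
  have hΛ'R : (0 : ℝ) < Λ' := by exact_mod_cast (show 0 < Λ' by omega)
  have key : ∑ x ∈ box dd L, fejerBox dd L x * periodize dd Λ (twoPointPlus dd β) x ≤
      ((ℓ : ℝ) / Λ') ^ dd * twoPointPlusFourier dd β 0 + cA d'' * (lam : ℝ) ^ 2 * (∑ x ∈ box dd ℓ, fejerBox dd ℓ x * periodize dd Λ' (twoPointPlus dd β) x + c) +
        ((dd : ℕ) : ℝ) ^ 2 * (lam : ℝ) ^ 2 / β := by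
    refine le_of_mul_le_mul_left (htot.trans (le_of_eq ?_)) hΛpos
    have hlam0 : (lam : ℝ) ≠ 0 := hlamR.ne'
    have hΛ'0 : (Λ' : ℝ) ≠ 0 := hΛ'R.ne'
    have e1 : (Λ : ℝ) ^ dd * (((ℓ : ℝ) / Λ') ^ dd * twoPointPlusFourier dd β 0) = (L : ℝ) ^ dd * twoPointPlusFourier dd β 0 := by
      rw [hΛR, hLR, mul_pow, mul_pow, div_pow]
      field_simp
    have e2 : CA' = cA d'' * (lam : ℝ) ^ dd * (lam : ℝ) ^ 2 := by
      rw [hCA', cA]; ring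
    have e3 : (Λ : ℝ) ^ dd = (lam : ℝ) ^ dd * (Λ' : ℝ) ^ dd := by rw [hΛR, mul_pow]
    simp only [mul_add]
    rw [e1, e2, e3]
    ring
  exact hstep1.trans key

end GridEstimate

/-! ### Part 3. The limit `Λ' → ∞`, boxes versus Fejér weights, `β ↑ β_c`, and the discharge -/

section Assembly

variable {d'' : ℕ}

local notation "dd" => d'' + 2

/-- **The two-scale inequality for the Fejér-weighted susceptibilities**: for `0 < β < β_c`,
`ℓ ≥ 1`, `λ ≥ 1`, `χ^F_{λℓ} ≤ c_A λ² [χ^F_ℓ + (d-1)/(4β)] + d²λ²/β` (the grid inequality with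
`Λ' → ∞`: `S_{Λ'} → S` termwise, the `k = 0` term vanishes). [cite: AizenmanDuminilCopinAnnals2021, arXiv:1912.07973 proof of Thm 5.6 (p. 19–20)] -/
theorem fejerSusc_scale_le {β : ℝ} (hβ : 0 < β) (hβc : β < criticalBeta dd) {ℓ lam : ℕ} (hℓ : 1 ≤ ℓ) (hlam : 1 ≤ lam) :
    fejerSusc d'' β (lam * ℓ) ≤
      cA d'' * (lam : ℝ) ^ 2 * (fejerSusc d'' β ℓ + (d'' + 1 : ℕ) / (4 * β)) + ((dd : ℕ) : ℝ) ^ 2 * (lam : ℝ) ^ 2 / β := by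
  have hS : Summable (twoPointPlus dd β) := summable_twoPointPlus_of_lt_criticalBeta (d := dd) (by omega) hβ.le hβc
  have hS0 : ∀ y, 0 ≤ twoPointPlus dd β y := fun y => twoPointPlus_nonneg_of_gks hβ.le y
  set g : ℕ → ℝ := fun n => ((ℓ : ℝ) / (n + ℓ + 1 : ℕ)) ^ dd * twoPointPlusFourier dd β 0 +
    cA d'' * (lam : ℝ) ^ 2 * (∑ x ∈ box dd ℓ, fejerBox dd ℓ x * periodize dd (n + ℓ + 1) (twoPointPlus dd β) x +
      (d'' + 1 : ℕ) / (4 * β)) + ((dd : ℕ) : ℝ) ^ 2 * (lam : ℝ) ^ 2 / β with hg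
  have hle : ∀ n, fejerSusc d'' β (lam * ℓ) ≤ g n := fun n =>
    fejerSusc_le_grid hβ hβc hℓ hlam (Λ' := n + ℓ + 1) (by omega)
  have hlim : Tendsto g atTop (𝓝 (0 * twoPointPlusFourier dd β 0 +
      cA d'' * (lam : ℝ) ^ 2 * (fejerSusc d'' β ℓ + (d'' + 1 : ℕ) / (4 * β)) + ((dd : ℕ) : ℝ) ^ 2 * (lam : ℝ) ^ 2 / β)) := by
    have hN : Tendsto (fun n : ℕ => n + ℓ + 1) atTop atTop := tendsto_atTop_atTop.2 fun b => ⟨b, fun n hn => by omega⟩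
    refine ((Tendsto.mul_const _ ?_).add (Tendsto.const_mul _ (Tendsto.add_const _ ?_))).add_const _
    · -- `(ℓ/(n+ℓ+1))^d → 0`
      have h1 : Tendsto (fun n : ℕ => (ℓ : ℝ) / (n + ℓ + 1 : ℕ)) atTop (𝓝 0) := by
        have := (tendsto_const_div_atTop_nhds_zero_nat (ℓ : ℝ)).comp hN
        exact this
      have := h1.pow dd
      rwa [zero_pow (by omega)] at this
    · unfold fejerSusc
      exact tendsto_finsetSum _ fun x _ => ((tendsto_periodize hS hS0 x).comp hN).const_mul _
  rw [zero_mul, zero_add] at hlim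
  exact ge_of_tendsto' hlim hle

/-- **Fejér weights versus boxes, lower scale**: `χ^F_{ℓ'} ≤ χ_ℓ` for `ℓ' ≤ ⌊ℓ⌋`. [folklore] -/
theorem fejerSusc_le_boxSusceptibility {β : ℝ} (hβ : 0 ≤ β) {ℓ' : ℕ} {ℓ : ℝ} (hℓ : 0 ≤ ℓ) (hℓ' : ℓ' ≤ ⌊ℓ⌋₊) :
    fejerSusc d'' β ℓ' ≤ boxSusceptibility (twoPointPlus dd β) ℓ := by
  rw [boxSusceptibility, latticeBox_eq_box hℓ, fejerSusc]
  calc ∑ x ∈ box dd ℓ', fejerBox dd ℓ' x * twoPointPlus dd β x ≤ ∑ x ∈ box dd ℓ', twoPointPlus dd β x :=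
        Finset.sum_le_sum fun x _ => mul_le_of_le_one_left (twoPointPlus_nonneg_of_gks hβ x) (fejerBox_le_one _ _)
    _ ≤ ∑ x ∈ box dd ⌊ℓ⌋₊, twoPointPlus dd β x :=
        Finset.sum_le_sum_of_subset_of_nonneg (box_mono dd hℓ') fun x _ _ => twoPointPlus_nonneg_of_gks hβ x

/-- **Fejér weights versus boxes, upper scale**: `χ_L ≤ 2^d χ^F_{L'}` for `L' ≥ 2⌊L⌋`, `L' ≥ 1`
(`F_{L'} ≥ 2^{-d}` on `Λ_L`). [folklore] -/
theorem boxSusceptibility_le_fejerSusc {β : ℝ} (hβ : 0 ≤ β) {L' : ℕ} {L : ℝ} (hL : 0 ≤ L) (hL'1 : 1 ≤ L')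
    (hL' : 2 * ⌊L⌋₊ ≤ L') :
    boxSusceptibility (twoPointPlus dd β) L ≤ (2 : ℝ) ^ dd * fejerSusc d'' β L' := by
  rw [boxSusceptibility, latticeBox_eq_box hL, fejerSusc, Finset.mul_sum]
  have hsub : box dd ⌊L⌋₊ ⊆ box dd L' := box_mono dd (by omega)
  calc ∑ x ∈ box dd ⌊L⌋₊, twoPointPlus dd β x
      ≤ ∑ x ∈ box dd ⌊L⌋₊, (2 : ℝ) ^ dd * (fejerBox dd L' x * twoPointPlus dd β x) := by
        refine Finset.sum_le_sum fun x hx => ?_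
        have hF : (1 / 2 : ℝ) ^ dd ≤ fejerBox dd L' x := by
          refine fejerBox_ge_of_two_mul_le hL'1 fun i => ?_
          have := (mem_box.1 hx) i
          have habs : |x i| ≤ (⌊L⌋₊ : ℤ) := abs_le.2 ⟨this.1, this.2⟩
          have hL'' : (2 * ⌊L⌋₊ : ℤ) ≤ L' := by exact_mod_cast hL'
          linarith
        have hS := twoPointPlus_nonneg_of_gks hβ x
        calc twoPointPlus dd β x = (2 : ℝ) ^ dd * ((1 / 2 : ℝ) ^ dd * twoPointPlus dd β x) := by
              rw [← mul_assoc, ← mul_pow]; norm_num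
          _ ≤ (2 : ℝ) ^ dd * (fejerBox dd L' x * twoPointPlus dd β x) := by gcongr
    _ ≤ ∑ x ∈ box dd L', (2 : ℝ) ^ dd * (fejerBox dd L' x * twoPointPlus dd β x) :=
        Finset.sum_le_sum_of_subset_of_nonneg hsub fun x _ _ =>
          mul_nonneg (by positivity) (mul_nonneg (fejerBox_nonneg _ _) (twoPointPlus_nonneg_of_gks hβ x))

variable (d'') in
/-- The final constant (dimension `d = d''+2`): `C_d = 25 · 2^d · (c_A β_c + c_A (d-1)/4 + d²)`. [folklore] -/
def cSliding : ℝ := 25 * (2 : ℝ) ^ dd * (cA d'' * criticalBeta dd + cA d'' * ((d'' + 1 : ℕ) : ℝ) / 4 + ((dd : ℕ) : ℝ) ^ 2)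

/-- `C_d > 0`. [folklore] -/
theorem cSliding_pos : 0 < cSliding d'' := by
  unfold cSliding
  have h1 : 0 ≤ cA d'' * criticalBeta dd := mul_nonneg cA_nonneg (criticalBeta_nonneg dd)
  have h2 : 0 ≤ cA d'' * ((d'' + 1 : ℕ) : ℝ) / 4 := by have := cA_nonneg (d'' := d''); positivity
  have h3 : (0 : ℝ) < ((dd : ℕ) : ℝ) ^ 2 := by positivity
  positivity

/-- **The sliding-scale infrared bound below `β_c`, for the plus state** (real scales):
for `0 < β < β_c` and `1 ≤ ℓ ≤ L`, `χ_L/L² ≤ (C_d/β) χ_ℓ/ℓ²` with `S = ⟨σ₀σ_x⟩⁺_β`.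
[cite: AizenmanDuminilCopinAnnals2021, arXiv:1912.07973 Thm 5.6 (p. 18)] -/
theorem boxSusceptibility_sliding_of_lt_criticalBeta {β : ℝ} (hβ : 0 < β) (hβc : β < criticalBeta dd) {ℓ L : ℝ}
    (hℓ : 1 ≤ ℓ) (hℓL : ℓ ≤ L) :
    boxSusceptibility (twoPointPlus dd β) L / L ^ 2 ≤
      cSliding d'' / β * (boxSusceptibility (twoPointPlus dd β) ℓ / ℓ ^ 2) := by
  have hL1 : 1 ≤ L := hℓ.trans hℓL
  -- integer scales
  set ℓ' : ℕ := ⌊ℓ⌋₊ with hℓ'def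
  set n : ℕ := ⌊L⌋₊ with hndef
  have hℓ'1 : 1 ≤ ℓ' := by rw [hℓ'def]; exact Nat.le_floor (by exact_mod_cast hℓ)
  set lam : ℕ := 2 * n / ℓ' + 1 with hlamdef
  have hlam1 : 1 ≤ lam := by rw [hlamdef]; exact Nat.le_add_left 1 _
  have hlamℓ' : 2 * n ≤ lam * ℓ' := by
    rw [hlamdef, add_mul, one_mul]
    have := Nat.div_add_mod (2 * n) ℓ'
    have hmod := Nat.mod_lt (2 * n) (show 0 < ℓ' by omega)
    rw [mul_comm] at this
    nlinarith
  -- the chain at integer scales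
  have hχF := fejerSusc_scale_le hβ hβc hℓ'1 hlam1
  have hlow := fejerSusc_le_boxSusceptibility (d'' := d'') hβ.le (ℓ' := ℓ') (by linarith) le_rfl
  have hup := boxSusceptibility_le_fejerSusc (d'' := d'') hβ.le (L := L) (by linarith)
    (L' := lam * ℓ') (Nat.one_le_iff_ne_zero.2 (Nat.mul_ne_zero (by omega) (by omega))) hlamℓ'
  have hone := one_le_fejerSusc (d'' := d'') hβ.le hℓ'1
  -- bound `λ ≤ 5 L/ℓ`
  have hℓ'ge : ℓ / 2 ≤ ℓ' := by
    rw [hℓ'def]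
    have h1 := Nat.lt_floor_add_one ℓ
    have h2 : (1 : ℝ) ≤ (⌊ℓ⌋₊ : ℝ) := by exact_mod_cast hℓ'1
    linarith
  have hlamR : (lam : ℝ) ≤ 5 * (L / ℓ) := by
    have h1 : (lam : ℝ) ≤ 2 * n / ℓ' + 1 := by
      rw [hlamdef]; push_cast
      have := Nat.cast_div_le (m := 2 * n) (n := ℓ') (α := ℝ)
      push_cast at this
      linarith
    have h2 : (n : ℝ) ≤ L := Nat.floor_le (by linarith)
    have hℓ'pos : (0 : ℝ) < ℓ' := by exact_mod_cast (show 0 < ℓ' by omega)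
    have h3 : (2 * n : ℝ) / ℓ' ≤ 4 * (L / ℓ) := by
      rw [div_le_iff₀ hℓ'pos]
      have hℓpos : (0 : ℝ) < ℓ := by linarith
      have : 4 * (L / ℓ) * ℓ' ≥ 4 * (L / ℓ) * (ℓ / 2) := by gcongr
      have e : 4 * (L / ℓ) * (ℓ / 2) = 2 * L := by field_simp; ring
      linarith
    have h4 : (1 : ℝ) ≤ L / ℓ := by rw [le_div_iff₀ (by linarith)]; linarith
    linarith
  have hlam2 : (lam : ℝ) ^ 2 ≤ 25 * (L / ℓ) ^ 2 := by
    have := pow_le_pow_left₀ (by positivity) hlamR 2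
    nlinarith
  -- constants: `c_A λ²(χ' + c) + d²λ²/β ≤ (λ²/β) K χ'`
  set χ' := fejerSusc d'' β ℓ' with hχ'
  set K : ℝ := cA d'' * criticalBeta dd + cA d'' * ((d'' + 1 : ℕ) : ℝ) / 4 + ((dd : ℕ) : ℝ) ^ 2 with hK
  have hK0 : 0 ≤ K := by
    have := cA_nonneg (d'' := d''); have := criticalBeta_nonneg dd; rw [hK]; positivity
  have hcomb : cA d'' * (lam : ℝ) ^ 2 * (χ' + (d'' + 1 : ℕ) / (4 * β)) + ((dd : ℕ) : ℝ) ^ 2 * (lam : ℝ) ^ 2 / β ≤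
      (lam : ℝ) ^ 2 / β * K * χ' := by
    have hcA := cA_nonneg (d'' := d'')
    rw [hK]
    have e : (lam : ℝ) ^ 2 / β * (cA d'' * criticalBeta dd + cA d'' * ((d'' + 1 : ℕ) : ℝ) / 4 + ((dd : ℕ) : ℝ) ^ 2) * χ' =
        (lam : ℝ) ^ 2 * (cA d'' * (criticalBeta dd / β) * χ' + cA d'' * (((d'' + 1 : ℕ) : ℝ) / (4 * β)) * χ' +
          ((dd : ℕ) : ℝ) ^ 2 / β * χ') := by
      field_simp
    rw [e]
    have h1 : cA d'' * χ' ≤ cA d'' * (criticalBeta dd / β) * χ' := by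
      have hr : (1 : ℝ) ≤ criticalBeta dd / β := by rw [le_div_iff₀ hβ]; linarith
      have hcχ : 0 ≤ cA d'' * χ' := mul_nonneg hcA (by linarith)
      calc cA d'' * χ' = cA d'' * χ' * 1 := (mul_one _).symm
        _ ≤ cA d'' * χ' * (criticalBeta dd / β) := mul_le_mul_of_nonneg_left hr hcχ
        _ = cA d'' * (criticalBeta dd / β) * χ' := by ring
    have h2 : cA d'' * ((d'' + 1 : ℕ) / (4 * β)) ≤ cA d'' * (((d'' + 1 : ℕ) : ℝ) / (4 * β)) * χ' :=
      le_mul_of_one_le_right (mul_nonneg hcA (by positivity)) hone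
    have h3 : ((dd : ℕ) : ℝ) ^ 2 / β ≤ ((dd : ℕ) : ℝ) ^ 2 / β * χ' := le_mul_of_one_le_right (by positivity) hone
    have hl2 : (0 : ℝ) ≤ (lam : ℝ) ^ 2 := by positivity
    have hsum3 : cA d'' * χ' + cA d'' * ((d'' + 1 : ℕ) / (4 * β)) + ((dd : ℕ) : ℝ) ^ 2 / β ≤
        cA d'' * (criticalBeta dd / β) * χ' + cA d'' * (((d'' + 1 : ℕ) : ℝ) / (4 * β)) * χ' + ((dd : ℕ) : ℝ) ^ 2 / β * χ' := by
      linarith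
    have := mul_le_mul_of_nonneg_left hsum3 hl2
    have e2 : cA d'' * (lam : ℝ) ^ 2 * (χ' + (d'' + 1 : ℕ) / (4 * β)) + ((dd : ℕ) : ℝ) ^ 2 * (lam : ℝ) ^ 2 / β =
        (lam : ℝ) ^ 2 * (cA d'' * χ' + cA d'' * ((d'' + 1 : ℕ) / (4 * β)) + ((dd : ℕ) : ℝ) ^ 2 / β) := by ring
    rw [e2]
    exact this
  -- assemble: `χ_L ≤ 2^d χ^F_{λℓ'} ≤ 2^d (λ²/β) K χ' ≤ 2^d (25 (L/ℓ)²/β) K χ_ℓ`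
  have hχL : boxSusceptibility (twoPointPlus dd β) L ≤ (2 : ℝ) ^ dd * ((lam : ℝ) ^ 2 / β * K * χ') :=
    hup.trans (mul_le_mul_of_nonneg_left (hχF.trans hcomb) (by positivity))
  have hχℓ0 : 0 ≤ boxSusceptibility (twoPointPlus dd β) ℓ := le_trans (by linarith) hlow
  have hfinal : boxSusceptibility (twoPointPlus dd β) L ≤ cSliding d'' / β * (L / ℓ) ^ 2 * boxSusceptibility (twoPointPlus dd β) ℓ := by
    refine hχL.trans ?_
    rw [cSliding, ← hK]
    have h1 : (lam : ℝ) ^ 2 / β * K * χ' ≤ 25 * (L / ℓ) ^ 2 / β * K * boxSusceptibility (twoPointPlus dd β) ℓ := by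
      have hlow' : χ' ≤ boxSusceptibility (twoPointPlus dd β) ℓ := hlow
      have hχ'0 : 0 ≤ χ' := by linarith
      calc (lam : ℝ) ^ 2 / β * K * χ' ≤ 25 * (L / ℓ) ^ 2 / β * K * χ' := by gcongr
        _ ≤ 25 * (L / ℓ) ^ 2 / β * K * boxSusceptibility (twoPointPlus dd β) ℓ := by gcongr
    calc (2 : ℝ) ^ dd * ((lam : ℝ) ^ 2 / β * K * χ') ≤ (2 : ℝ) ^ dd * (25 * (L / ℓ) ^ 2 / β * K * boxSusceptibility (twoPointPlus dd β) ℓ) := by gcongr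
      _ = 25 * (2 : ℝ) ^ dd * K / β * (L / ℓ) ^ 2 * boxSusceptibility (twoPointPlus dd β) ℓ := by ring
  have hLpos : (0 : ℝ) < L := by linarith
  have hℓpos : (0 : ℝ) < ℓ := by linarith
  rw [div_le_iff₀ (by positivity)]
  calc boxSusceptibility (twoPointPlus dd β) L ≤ cSliding d'' / β * (L / ℓ) ^ 2 * boxSusceptibility (twoPointPlus dd β) ℓ := hfinal
    _ = cSliding d'' / β * (boxSusceptibility (twoPointPlus dd β) ℓ / ℓ ^ 2) * L ^ 2 := by field_simp

/-- **The two-point function of any Gibbs state at `0 ≤ β ≤ β_c`, `d ≥ 3`, is the free one**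
(uniqueness of the Gibbs measure up to and at `β_c`). [cite: AizenmanDuminilCopinSidoraviciusCMP2015, Thm. 1.2 with Cor. 1.5 (1)] -/
theorem twoPoint_eq_twoPointFree_of_isingGibbsMeasure (hd : 3 ≤ dd) {β : ℝ} (hβ : 0 ≤ β) (hβc : β ≤ criticalBeta dd)
    {μ : Measure (SpinConfig (Site dd))} (hμ : μ ∈ isingGibbsMeasures dd β 0) (x : Site dd) :
    twoPoint μ spinAt 0 x = twoPointFree dd β x := by
  obtain ⟨_, htwo⟩ := isingGibbsMeasure_twoPoint_of_facts
    hasUniqueGibbsMeasure_of_lt_criticalBeta_holds hasUniqueGibbsMeasure_criticalBeta_holds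
    (fun d => exists_freeMeasure_holds d 0) hd hβ hβc hμ
  rw [show twoPoint μ spinAt 0 x = ∫ ω, spinAt 0 ω * spinAt x ω ∂μ from rfl, htwo 0 x, sub_zero]

/-- **Left-continuity of the box susceptibility of the free state at `β_c`** (finite sums of the
left-continuous `β ↦ ⟨σ₀σ_x⟩^∅_β`, ADS15 (3.18)). [cite: AizenmanDuminilCopinSidoraviciusCMP2015, §3.3, arXiv v3 eq. (3.18)] -/
theorem tendsto_boxSusceptibility_twoPointFree_left (R : ℝ) :
    Tendsto (fun β : ℝ => boxSusceptibility (twoPointFree dd β) R) (𝓝[<] criticalBeta dd)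
      (𝓝 (boxSusceptibility (twoPointFree dd (criticalBeta dd)) R)) := by
  have hLC : ads_freePair_leftContinuous (d := dd) :=
    ads_freePair_leftContinuous_of_gks (fun G' _ Λ A B β h bc => Literature.Probability.LatticeModels.GKSInequalities.gks_two_holds G')
      (@hasBoxLimit_isingCorr_free_holds dd) criticalBeta_pos_holds
  unfold boxSusceptibility
  refine tendsto_finsetSum _ fun x _ => ?_
  have := hLC (by omega) 0 x
  simpa only [freePair_zero_left] using this

/-- **Aizenman–Duminil-Copin 2021, Theorem 5.6 (sliding-scale infrared bound) — discharged.**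
For the nearest-neighbour Ising model on `ℤ^d`, `d ≥ 3`, there is `C = C(d) > 0` such that for all
`0 < β ≤ β_c`, `1 ≤ ℓ ≤ L` and every Gibbs state `μ ∈ 𝒢(β, 0)`,
`χ_L(β)/L² ≤ (C/β) χ_ℓ(β)/ℓ²`. Proof (the tree's programme V1–V5): the transfer-matrix
monotonicity of `Ŝ` in each `|p_i|` and of `ℰ₁(p_i)Ŝ` (torus, `TorusTransferSpectral`, passed to
infinite volume in `SubcriticalFourier`), the diagonal monotonicity of `Ŝ^{mod}` (rotated torus,
`RotatedTorus*`, `SubcriticalFourierDiagonal`), the infrared bound, and a Fejér-kernel / momentum-grid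
rendering of the two-scale comparison (`FejerKernel`, `DiscreteParseval`, this file); `β = β_c` by the
left-continuity of the free state and the uniqueness of the critical Gibbs measure.
[cite: AizenmanDuminilCopinAnnals2021, arXiv:1912.07973 Thm 5.6 (p. 18)] -/
theorem aizenmanDuminilCopin_slidingScaleInfraredBound_holds : aizenmanDuminilCopin_slidingScaleInfraredBound := by
  intro d hd
  obtain ⟨d'', rfl⟩ : ∃ d'', d = d'' + 2 := ⟨d - 2, by omega⟩
  refine ⟨cSliding d'', cSliding_pos, fun β ℓ L hβ hβc hℓ hℓL μ hμ => ?_⟩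
  have hd3 : 3 ≤ d'' + 2 := hd
  -- the two-point function of `μ` is the free one
  have hS : twoPoint μ spinAt 0 = twoPointFree (d'' + 2) β :=
    funext fun x => twoPoint_eq_twoPointFree_of_isingGibbsMeasure hd3 hβ.le hβc hμ x
  rw [hS]
  -- below `β_c` the free state is the plus state and the bound is `boxSusceptibility_sliding_of_lt_criticalBeta`
  have hlt : ∀ β', 0 < β' → β' < criticalBeta (d'' + 2) →
      boxSusceptibility (twoPointFree (d'' + 2) β') L / L ^ 2 ≤
        cSliding d'' / β' * (boxSusceptibility (twoPointFree (d'' + 2) β') ℓ / ℓ ^ 2) := by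
    intro β' hβ' hβ'c
    have hm : spontaneousMagnetization (d'' + 2) β' = 0 := spontaneousMagnetization_eq_zero_of_lt_criticalBeta_holds hβ'.le hβ'c
    have hfp : twoPointFree (d'' + 2) β' = twoPointPlus (d'' + 2) β' :=
      funext fun x => twoPointFree_eq_twoPointPlus_of_spontaneousMagnetization_eq_zero hβ'.le hm x
    rw [hfp]
    exact boxSusceptibility_sliding_of_lt_criticalBeta hβ' hβ'c hℓ hℓL
  rcases hβc.lt_or_eq with hlt' | heq
  · exact hlt β hβ hlt'
  · -- `β = β_c`: pass to the limit `β' ↑ β_c`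
    subst heq
    have hβc_pos : 0 < criticalBeta (d'' + 2) := hβ
    have h1 := (tendsto_boxSusceptibility_twoPointFree_left (d'' := d'') L).div_const (L ^ 2)
    have h2 : Tendsto (fun β' : ℝ => cSliding d'' / β' * (boxSusceptibility (twoPointFree (d'' + 2) β') ℓ / ℓ ^ 2))
        (𝓝[<] criticalBeta (d'' + 2))
        (𝓝 (cSliding d'' / criticalBeta (d'' + 2) * (boxSusceptibility (twoPointFree (d'' + 2) (criticalBeta (d'' + 2))) ℓ / ℓ ^ 2))) := by
      refine Tendsto.mul ?_ ((tendsto_boxSusceptibility_twoPointFree_left (d'' := d'') ℓ).div_const (ℓ ^ 2))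
      have hcont : ContinuousAt (fun β' : ℝ => cSliding d'' / β') (criticalBeta (d'' + 2)) :=
        continuousAt_const.div continuousAt_id hβc_pos.ne'
      exact hcont.tendsto.mono_left nhdsWithin_le_nhds
    refine le_of_tendsto_of_tendsto h1 h2 ?_
    filter_upwards [Ioo_mem_nhdsLT hβc_pos] with β' hβ'
    exact hlt β' hβ'.1 hβ'.2

end Assembly

end Literature.Probability.LatticeModels

end
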